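import Summits.MatrixMultiplication.MatrixMultiplication.Theses.ConeDesigns
import Summits.MatrixMultiplication.MatrixMultiplication.Theorems.AlgebraicSTPPDichotomyExactLineDesignRefutation

/-!
# Refutation of `ConeDesigns.ConeDesignThesis` (stmt-MatrixMultiplication-9759)

`ConeDesignThesis` asks for a FIXED rank `n` such that for every `θ > 0` and arbitrarily large
primes `q` there is a cone STPP design in `(ZMod q)^n` — `N` triples of punctured lines
`(F_q^× aᵢ, F_q^× bᵢ, F_q^× cᵢ)` satisfying `IsSTPP` — with `N ≥ q^{n−2−θ}` (packing-tight up to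
`q^{o(1)}`).  It is the prime-field special case of `AlgebraicSTPPDichotomy.ExactLineDesign`
(`F = ZMod q`, `m = n`, blocks = the inlined cone Finsets), which is refuted in the tree
(`AlgebraicSTPPDichotomyExactLineDesign_refuted`, from
`Literature.Computability.AlgebraicComplexity.IsSTPP.lineFamily_card_bound`:
every punctured-line STPP family in `F^m`, `|F| = q ≥ 3`, `m ≥ 2`, has
`N (q−1)²(q+1) + 7 < 7 q^m`, i.e. `N < 28 q^{m−3}` — a full factor `q^{1−o(1)}` below packing at
every rank).  The reduction (same vectors, same blocks, `Fintype.card (ZMod q) = q`) is the whole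
proof.
-/

open Literature.Computability.AlgebraicComplexity

namespace Summit.MatrixMultiplication.MatrixMultiplication.Theorems

/-- Refutes `ConeDesigns.ConeDesignThesis` [refuted-substantive] (stmt-MatrixMultiplication-9759):
for EVERY rank `n` and every prime `q ≥ 3`, every cone STPP design of `N` triples of punctured
lines in `(ZMod q)^n` has `N (q−1)²(q+1) + 7 < 7 qⁿ` (`IsSTPP.lineFamily_card_bound`: the three
colour cones `⋃(Aᵢ−Bᵢ)`, `⋃(Bⱼ−Cⱼ)`, `⋃(C_k−A_k)` admit no off-diagonal zero sum, three collinear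
projective points one in each would rescale to one, and a second-moment count over the lines of
`PG(n−1,q)` finds a line rich in all three once the densities exceed `7/(q+1)`), hence
`N < 28 q^{n−3}`; with `θ = 1/2`, `q₀ = 784` the required `N ≥ q^{n−2−θ}` forces `√q < 28`,
contradiction.  Witness: none needed (universal bound; formally the prime-field instance
`F = ZMod q` of the landed `AlgebraicSTPPDichotomyExactLineDesign_refuted`).  The cone (punctured-
line) class loses a full power `q^{1−o(1)}` against packing at every bounded rank, so the route's
own kill criterion (ConeBarrier at every rank, here with `η = 1/2`, `q₀ = 784`) is met.
No cheap repair: (i) restricting/enlarging the rank `n`, or passing to prime powers, changes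
nothing (the bound is uniform in `n` and in the finite field); (ii) weakening the exponent to the
true order `N ≥ c·q^{n−3}` survives but certifies only `(q−1)^ω ≤ q³/c`, i.e. nothing below
`ω ≤ 3`, never `ω ≤ 2 + θ` — the assembly `closes` dies with it; (iii) multi-line cones / frames of
equal dimension `d` are killed by the same count type by type (FrameBarrier, tree).  Only NON-cone
definable designs escape the line lemma (other routes).
barrier-candidate: bounded-rank cone barrier — scalar-invariant (punctured-subspace) STPP designs
in `F_q^n`, `n` fixed, `q → ∞`, sit a factor `(q+1)/7` below packing and certify no `ω < 2 + 1/d`.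
[folklore] -/
theorem ConeDesignsConeDesignThesis_refuted :
    ¬ Summit.MatrixMultiplication.MatrixMultiplication.Theses.ConeDesigns.ConeDesignThesis := by
  rintro ⟨n, hn⟩
  refine AlgebraicSTPPDichotomyExactLineDesign_refuted ⟨n, fun δ hδ q₀ => ?_⟩
  obtain ⟨q, hq, hp, N, a, b, c, hne, hS, hN⟩ := hn δ hδ q₀
  refine ⟨ZMod q, inferInstance, inferInstance, ?_, N, a, b, c, _, _, _, hne, ?_, ?_, ?_, hS, ?_⟩
  · simpa [ZMod.card q] using hq
  · intro i v; simp [Finset.mem_erase, Finset.mem_image, eq_comm]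
  · intro i v; simp [Finset.mem_erase, Finset.mem_image, eq_comm]
  · intro i v; simp [Finset.mem_erase, Finset.mem_image, eq_comm]
  · simpa [ZMod.card q] using hN

end Summit.MatrixMultiplication.MatrixMultiplication.Theorems
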